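import Summits.Ventures.CertifiedManyBodySolver.Downfold.OneBandLineFermiPoints
import HarnessLib

/-!
# The direct one-band in-plane band, IX: the Γ–X AXIS profile, the nature of X, and the EXTENDED (off-X) SADDLE —
# axis-maximum bracket, location, strip minimum, and the two van Hove fillings by cell trees

Venture CertifiedManyBodySolver, cell `pub/hubbard-downfold` (stage S1, technique B; INFL-3to1-B), seat hubbard-downfold-mod-4
(g25); namespace `Summit.Ventures.CertifiedManyBodySolver.Downfold.Emery`. Everything PROVED; no number lives here. WHAT
THIS IS NOT: a statement about any material; `U = 0` one-body kinematics of a one-band Wannier Hamiltonian.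

In the monotone class (`IpAnti`, g23 `OneBandInPlaneFilling` §4) the saddle point of the band is X = (π, 0): the maximum
of the band along the axis `ky = 0` and the minimum along the zone face. When `2|t′| + 4t″ ≳ t` (large `t″`, e.g. the
cell's PBE one-band legs of Bi-2212) the axis profile `kx ↦ ε(kx, 0)` is no longer monotone: its maximum moves OFF X to
an interior point `(k₀, 0)` — the «extended saddle» — and X becomes a local minimum (or a second, lower saddle). This file
certifies that structure from exact rational evaluations, one-variable / two-variable kd certificates and the cell trees:

* §1 the axis profile `ipAxis S w = ε(w, 1)` (`w = cos kx`; `ipBandK_axis`), its derivative and `ArithExpr` mirrors;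
* §2 the nature of X: `axis_le_X_of_check` (axis profile below `ε(X)` on `cos kx ≤ w₁`: X a local MAXIMUM along the
  axis), `X_le_axis_of_check` (X a local MINIMUM along the axis), `X_le_band_of_checks` (X a local minimum of the BAND
  on the corner box `cos kx ≤ w₁, cos ky ≥ v₁`);
* §3 the AXIS MAXIMUM `axisMax S = max_{kx} ε(kx, 0)` (attained), the check `axisMaxCheck` ⇒ `axisMax ∈ [e_lo, e_hi]`,
  every maximiser has `cos kx ∈ (wa, wb)`, and the profile is `≤ e_side < e_lo` outside — in particular
  `ε(X) < axisMax` (`axisMax_of_check`);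
* §4 the STRIP MINIMUM (`∂_v ε ≤ 0` on `[wa, wb] × [v₁, 1]`) ⇒ the maximiser `(k₀, 0)` is a SADDLE: maximum along the
  axis, minimum across it (`axisSaddle_of_checks`);
* §5 the two VAN HOVE FILLINGS by `K = 384` cell trees: at `ε(X)` (exact rational energy, `X_filling_of_tree`) and at
  `axisMax` (two trees at `e_lo`, `e_hi`; `axisMax_filling_of_trees`).

Sources: `t–t′–t″` form and its saddle point [AndersenEtAl1995, §6]; interval / subdivision verification
[Moore1966, Theorem 3.1, §4.4].
-/

noncomputable section

namespace Summit.Ventures.CertifiedManyBodySolver.Downfold.Emery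

open Real Set Literature.Analysis.ValidatedNumerics

/-! ## §1 The axis profile -/

/-- The band on the axis `ky = 0` as a function of `w = cos kx`: `ε(w, 1)`. [cite: AndersenEtAl1995, §6] -/
def ipAxis (S : List (ℕ × ℕ × ℚ)) (w : ℝ) : ℝ := ipBandUV S w 1

/-- `ε(kx, 0) = ipAxis S (cos kx)`. [folklore] -/
theorem ipBandK_axis {S : List (ℕ × ℕ × ℚ)} (hS : shellsOK S = true) (kx : ℝ) : ipBandK S kx 0 = ipAxis S (cos kx) := by
  rw [ipBandK_eq_UV hS, cos_zero]; rfl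

/-- `ipAxis S (−1) = ε(X)`. [folklore] -/
theorem ipAxis_neg_one {S : List (ℕ × ℕ × ℚ)} (hS : shellsOK S = true) : ipAxis S (-1) = ipBandK S π 0 := by
  rw [ipBandK_axis hS, cos_pi]

/-- [folklore] -/
theorem continuous_ipAxis (S : List (ℕ × ℕ × ℚ)) : Continuous (ipAxis S) :=
  (continuous_ipBandUV₂ S).comp (continuous_id.prodMk continuous_const)

/-- `d/dw ipAxis = ∂_u ε(w, 1)`. [folklore] -/
theorem hasDerivAt_ipAxis (S : List (ℕ × ℕ × ℚ)) (w : ℝ) : HasDerivAt (ipAxis S) (ipBandU S w 1) w := by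
  unfold ipAxis; exact hasDerivAt_ipBandUV S w 1

/-- The axis profile as a one-variable `ArithExpr` (`x 0 = w`). [folklore] -/
def ipAxisE (S : List (ℕ × ℕ × ℚ)) : ArithExpr := ipBandGE S (.var 0) (.const 1)

/-- Its derivative as a one-variable `ArithExpr`. [folklore] -/
def ipAxisDE (S : List (ℕ × ℕ × ℚ)) : ArithExpr := ipBandUGE S (.var 0) (.const 1)

/-- [folklore] -/
theorem eval_ipAxisE (S : List (ℕ × ℕ × ℚ)) (x : ℕ → ℝ) : (ipAxisE S).eval x = ipAxis S (x 0) := by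
  simp [ipAxisE, eval_ipBandGE, ipAxis]

/-- [folklore] -/
theorem eval_ipAxisDE (S : List (ℕ × ℕ × ℚ)) (x : ℕ → ℝ) : (ipAxisDE S).eval x = ipBandU S (x 0) 1 := by
  simp [ipAxisDE, eval_ipBandUGE]

/-! ## §2 The nature of X = (π, 0) -/

/-- kd certificate: `∂_w ipAxis ≤ 0` on `[−1, w₁]` (profile DEcreasing in `w`, i.e. the band INcreasing in `kx` up to X).
[cite: Moore1966, Theorem 3.1, §4.4] -/
def ipAxisDecCheck (S : List (ℕ × ℕ × ℚ)) (w₁ : ℚ) (t : KdCert ℕ) : Bool :=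
  decide (-1 ≤ w₁) && t.check (exprLeOn (ipAxisDE S) 0) [(-1, w₁)]

/-- kd certificate: `∂_w ipAxis ≥ 0` on `[−1, w₁]` (the band DEcreasing in `kx` into X: X a local minimum along the axis).
[cite: Moore1966, Theorem 3.1, §4.4] -/
def ipAxisIncCheck (S : List (ℕ × ℕ × ℚ)) (w₁ : ℚ) (t : KdCert ℕ) : Bool :=
  decide (-1 ≤ w₁) && t.check (exprLeOn (.neg (ipAxisDE S)) 0) [(-1, w₁)]

/-- **X is a local MAXIMUM along the axis**: `ε(kx, 0) ≤ ε(X)` whenever `cos kx ≤ w₁`. [folklore] -/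
theorem axis_le_X_of_check {S : List (ℕ × ℕ × ℚ)} (hS : shellsOK S = true) {w₁ : ℚ} {t : KdCert ℕ}
    (h : ipAxisDecCheck S w₁ t = true) {kx : ℝ} (hkx : cos kx ≤ (w₁ : ℝ)) : ipBandK S kx 0 ≤ ipBandK S π 0 := by
  simp only [ipAxisDecCheck, Bool.and_eq_true, decide_eq_true_eq] at h
  obtain ⟨hw, hk⟩ := h
  have hd : ∀ w ∈ Icc (-1 : ℝ) w₁, ipBandU S w 1 ≤ 0 := by
    intro w hw'
    have hw'' : w ∈ Icc (((-1 : ℚ) : ℚ) : ℝ) ((w₁ : ℚ) : ℝ) := by simpa using hw'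
    have := eval_le_of_kdCheck hk _ (box_mem₁ hw'')
    simpa [eval_ipAxisDE] using this
  have hanti : AntitoneOn (ipAxis S) (Icc (-1 : ℝ) w₁) := by
    refine antitoneOn_of_deriv_nonpos (convex_Icc _ _) (continuous_ipAxis S).continuousOn ?_ ?_
    · exact fun w _ => (hasDerivAt_ipAxis S w).differentiableAt.differentiableWithinAt
    · intro w hw'
      rw [interior_Icc] at hw'
      rw [(hasDerivAt_ipAxis S w).deriv]
      exact hd w (Ioo_subset_Icc_self hw')
  rw [ipBandK_axis hS kx, ← ipAxis_neg_one hS]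
  have hw' : (-1 : ℝ) ≤ w₁ := by exact_mod_cast hw
  exact hanti ⟨le_rfl, hw'⟩ ⟨neg_one_le_cos kx, hkx⟩ (neg_one_le_cos kx)

/-- **X is a local MINIMUM along the axis**: `ε(X) ≤ ε(kx, 0)` whenever `cos kx ≤ w₁`. [folklore] -/
theorem X_le_axis_of_check {S : List (ℕ × ℕ × ℚ)} (hS : shellsOK S = true) {w₁ : ℚ} {t : KdCert ℕ}
    (h : ipAxisIncCheck S w₁ t = true) {kx : ℝ} (hkx : cos kx ≤ (w₁ : ℝ)) : ipBandK S π 0 ≤ ipBandK S kx 0 := by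
  simp only [ipAxisIncCheck, Bool.and_eq_true, decide_eq_true_eq] at h
  obtain ⟨hw, hk⟩ := h
  have hd : ∀ w ∈ Icc (-1 : ℝ) w₁, 0 ≤ ipBandU S w 1 := by
    intro w hw'
    have hw'' : w ∈ Icc (((-1 : ℚ) : ℚ) : ℝ) ((w₁ : ℚ) : ℝ) := by simpa using hw'
    have := eval_le_of_kdCheck hk _ (box_mem₁ hw'')
    simp [eval_ipAxisDE] at this
    linarith
  have hmono : MonotoneOn (ipAxis S) (Icc (-1 : ℝ) w₁) := by
    refine monotoneOn_of_deriv_nonneg (convex_Icc _ _) (continuous_ipAxis S).continuousOn ?_ ?_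
    · exact fun w _ => (hasDerivAt_ipAxis S w).differentiableAt.differentiableWithinAt
    · intro w hw'
      rw [interior_Icc] at hw'
      rw [(hasDerivAt_ipAxis S w).deriv]
      exact hd w (Ioo_subset_Icc_self hw')
  rw [ipBandK_axis hS kx, ← ipAxis_neg_one hS]
  have hw' : (-1 : ℝ) ≤ w₁ := by exact_mod_cast hw
  exact hmono ⟨le_rfl, hw'⟩ ⟨neg_one_le_cos kx, hkx⟩ (neg_one_le_cos kx)

/-- Two-variable kd certificate: `∂_u ε ≥ 0` on the corner box `[−1, w₁] × [v₁, 1]`. [cite: Moore1966, Theorem 3.1, §4.4] -/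
def ipCornerIncCheck (S : List (ℕ × ℕ × ℚ)) (w₁ v₁ : ℚ) (t : KdCert ℕ) : Bool :=
  decide (-1 ≤ w₁) && decide (v₁ ≤ 1) && t.check (exprLeOn (.neg (ipBandUE S)) 0) [(-1, w₁), (v₁, 1)]

/-- **X is a local MINIMUM of the band** (extended-saddle class): `ε(X) ≤ ε(kx, ky)` whenever `cos kx ≤ w₁` and
`cos ky ≥ v₁`, from `∂_u ε ≥ 0` on the corner box and the face monotonicity `FaceAnti`. [folklore] -/
theorem X_le_band_of_checks {S : List (ℕ × ℕ × ℚ)} (hS : shellsOK S = true) {w₁ v₁ : ℚ} {t tf : KdCert ℕ}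
    (hc : ipCornerIncCheck S w₁ v₁ t = true) (hf : ipFaceMonoCheck S tf = true)
    {kx ky : ℝ} (hkx : cos kx ≤ (w₁ : ℝ)) (hky : (v₁ : ℝ) ≤ cos ky) : ipBandK S π 0 ≤ ipBandK S kx ky := by
  simp only [ipCornerIncCheck, Bool.and_eq_true, decide_eq_true_eq] at hc
  obtain ⟨⟨hw, hv⟩, hk⟩ := hc
  have hw' : (-1 : ℝ) ≤ w₁ := by exact_mod_cast hw
  set v := cos ky with hv_def
  have hvI : v ∈ Icc ((v₁ : ℚ) : ℝ) ((1 : ℚ) : ℝ) := by push_cast; exact ⟨hky, cos_le_one ky⟩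
  have hd : ∀ u ∈ Icc (-1 : ℝ) w₁, 0 ≤ ipBandU S u v := by
    intro u hu
    have hu' : u ∈ Icc (((-1 : ℚ) : ℚ) : ℝ) ((w₁ : ℚ) : ℝ) := by simpa using hu
    have := eval_le_of_kdCheck₂ (e := .neg (ipBandUE S)) (b := 0) hk hu' hvI
    simp at this
    linarith
  have hmono : MonotoneOn (fun u => ipBandUV S u v) (Icc (-1 : ℝ) w₁) := by
    refine monotoneOn_of_deriv_nonneg (convex_Icc _ _) ?_ ?_ ?_
    · exact fun u _ => (hasDerivAt_ipBandUV S u v).continuousAt.continuousWithinAt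
    · exact fun u _ => (hasDerivAt_ipBandUV S u v).differentiableAt.differentiableWithinAt
    · intro u hu
      rw [interior_Icc] at hu
      rw [(hasDerivAt_ipBandUV S u v).deriv]
      exact hd u (Ioo_subset_Icc_self hu)
  have h1 : ipBandUV S (-1) v ≤ ipBandUV S (cos kx) v :=
    hmono ⟨le_rfl, hw'⟩ ⟨neg_one_le_cos kx, hkx⟩ (neg_one_le_cos kx)
  have h2 : ipBandUV S (-1) 1 ≤ ipBandUV S (-1) v := by
    have := faceAnti_of_kdCheck hf ⟨neg_one_le_cos ky, cos_le_one ky⟩ (by norm_num : (1 : ℝ) ∈ Icc (-1 : ℝ) 1)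
      (cos_le_one ky)
    simpa [ipFace] using this
  rw [ipBandK_eq_UV hS, ipBandK_eq_UV hS, cos_pi, cos_zero]
  exact h2.trans h1

/-! ## §3 The axis maximum -/

/-- THE AXIS MAXIMUM `max_{kx} ε(kx, 0) = max_{w ∈ [−1, 1]} ipAxis S w`. [cite: AndersenEtAl1995, §6] -/
def axisMax (S : List (ℕ × ℕ × ℚ)) : ℝ := sSup (ipAxis S '' Icc (-1 : ℝ) 1)

/-- The axis maximum is attained on `[−1, 1]` and bounds the profile. [folklore] -/
theorem axisMax_spec (S : List (ℕ × ℕ × ℚ)) :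
    (∃ w₀ ∈ Icc (-1 : ℝ) 1, ipAxis S w₀ = axisMax S) ∧ ∀ w ∈ Icc (-1 : ℝ) 1, ipAxis S w ≤ axisMax S := by
  have hne : (Icc (-1 : ℝ) 1).Nonempty := ⟨0, by norm_num⟩
  obtain ⟨w₀, hw₀, hmax⟩ := isCompact_Icc.exists_isMaxOn hne (continuous_ipAxis S).continuousOn
  have hgr : IsGreatest (ipAxis S '' Icc (-1 : ℝ) 1) (ipAxis S w₀) :=
    ⟨⟨w₀, hw₀, rfl⟩, by rintro _ ⟨w, hw, rfl⟩; exact hmax hw⟩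
  have heq : axisMax S = ipAxis S w₀ := hgr.csSup_eq
  exact ⟨⟨w₀, hw₀, heq.symm⟩, fun w hw => heq ▸ hmax hw⟩

/-- **The band on the axis is at most `axisMax`.** [folklore] -/
theorem ipBandK_axis_le_axisMax {S : List (ℕ × ℕ × ℚ)} (hS : shellsOK S = true) (kx : ℝ) :
    ipBandK S kx 0 ≤ axisMax S := by
  rw [ipBandK_axis hS]; exact (axisMax_spec S).2 _ ⟨neg_one_le_cos kx, cos_le_one kx⟩

/-- AXIS-MAXIMUM CHECK: `−1 < wa ≤ wpt ≤ wb < 1`, `e_side < e_lo ≤ ipAxis(wpt)` (exact), and kd certificates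
`ipAxis ≤ e_hi` on `[wa, wb]`, `ipAxis ≤ e_side` on `[−1, wa]` and on `[wb, 1]`. [folklore] -/
def axisMaxCheck (S : List (ℕ × ℕ × ℚ)) (elo ehi eside wa wb wpt : ℚ) (t₁ t₂ t₃ : KdCert ℕ) : Bool :=
  decide (-1 < wa) && decide (wa ≤ wpt) && decide (wpt ≤ wb) && decide (wb < 1) && decide (eside < elo) &&
  decide (elo ≤ ipBandQ S wpt 1) &&
  t₁.check (exprLeOn (ipAxisE S) ehi) [(wa, wb)] &&
  t₂.check (exprLeOn (ipAxisE S) eside) [(-1, wa)] &&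
  t₃.check (exprLeOn (ipAxisE S) eside) [(wb, 1)]

/-- **THE AXIS MAXIMUM THEOREM**: `axisMax ∈ [e_lo, e_hi]`; every maximiser lies in `(wa, wb)`; outside `(wa, wb)` the
profile is `≤ e_side`; in particular `ε(X) ≤ e_side < e_lo ≤ axisMax` — the maximum is OFF X. [folklore] -/
theorem axisMax_of_check {S : List (ℕ × ℕ × ℚ)} (hS : shellsOK S = true) {elo ehi eside wa wb wpt : ℚ}
    {t₁ t₂ t₃ : KdCert ℕ} (h : axisMaxCheck S elo ehi eside wa wb wpt t₁ t₂ t₃ = true) :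
    axisMax S ∈ Icc (elo : ℝ) ehi ∧
    (∀ w ∈ Icc (-1 : ℝ) 1, ipAxis S w = axisMax S → w ∈ Ioo (wa : ℝ) wb) ∧
    (∀ w ∈ Icc (-1 : ℝ) 1, w ∉ Ioo (wa : ℝ) wb → ipAxis S w ≤ eside) ∧
    ipBandK S π 0 ≤ (eside : ℝ) ∧ (eside : ℝ) < elo := by
  simp only [axisMaxCheck, Bool.and_eq_true, decide_eq_true_eq] at h
  obtain ⟨⟨⟨⟨⟨⟨⟨⟨hwa, hap⟩, hpb⟩, hwb⟩, hse⟩, hpt⟩, hk1⟩, hk2⟩, hk3⟩ := h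
  have hwa' : (-1 : ℝ) < wa := by exact_mod_cast hwa
  have hwb' : (wb : ℝ) < 1 := by exact_mod_cast hwb
  have hse' : (eside : ℝ) < elo := by exact_mod_cast hse
  have hpt' : (elo : ℝ) ≤ ipAxis S wpt := by
    have := (Rat.cast_le (K := ℝ)).2 hpt
    rw [cast_ipBandQ] at this; push_cast at this; exact this
  obtain ⟨⟨w₀, hw₀, hw₀eq⟩, hle⟩ := axisMax_spec S
  -- outside the bracket the profile is ≤ eside
  have hout : ∀ w ∈ Icc (-1 : ℝ) 1, w ∉ Ioo (wa : ℝ) wb → ipAxis S w ≤ eside := by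
    intro w hw hnot
    rw [mem_Ioo, not_and_or, not_lt, not_lt] at hnot
    rcases hnot with h1 | h1
    · have hwI : w ∈ Icc (((-1 : ℚ) : ℚ) : ℝ) ((wa : ℚ) : ℝ) := by push_cast; exact ⟨hw.1, h1⟩
      have := eval_le_of_kdCheck hk2 _ (box_mem₁ hwI)
      simpa [eval_ipAxisE] using this
    · have hwI : w ∈ Icc ((wb : ℚ) : ℝ) (((1 : ℚ) : ℚ) : ℝ) := by push_cast; exact ⟨h1, hw.2⟩
      have := eval_le_of_kdCheck hk3 _ (box_mem₁ hwI)
      simpa [eval_ipAxisE] using this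
  have hlo : (elo : ℝ) ≤ axisMax S :=
    hpt'.trans (hle _ ⟨by linarith [(show ((wa : ℚ) : ℝ) ≤ wpt by exact_mod_cast hap)],
      by linarith [(show ((wpt : ℚ) : ℝ) ≤ wb by exact_mod_cast hpb)]⟩)
  -- every maximiser is inside the open bracket
  have hin : ∀ w ∈ Icc (-1 : ℝ) 1, ipAxis S w = axisMax S → w ∈ Ioo (wa : ℝ) wb := by
    intro w hw hweq
    by_contra hnot
    have := hout w hw hnot
    linarith
  have hw₀in := hin w₀ hw₀ hw₀eq
  have hhi : axisMax S ≤ ehi := by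
    rw [← hw₀eq]
    have := eval_le_of_kdCheck hk1 _ (box_mem₁ (Ioo_subset_Icc_self hw₀in))
    simpa [eval_ipAxisE] using this
  have hX : ipBandK S π 0 ≤ eside := by
    rw [← ipAxis_neg_one hS]
    exact hout (-1) (by norm_num) (fun hm => by linarith [hm.1])
  exact ⟨⟨hlo, hhi⟩, hin, hout, hX, hse'⟩

/-- **There IS a momentum on the axis where the maximum is attained**, with `cos kx₀ ∈ (wa, wb)`. [folklore] -/
theorem exists_axisMax {S : List (ℕ × ℕ × ℚ)} (hS : shellsOK S = true) {elo ehi eside wa wb wpt : ℚ}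
    {t₁ t₂ t₃ : KdCert ℕ} (h : axisMaxCheck S elo ehi eside wa wb wpt t₁ t₂ t₃ = true) :
    ∃ kx₀ ∈ Icc (0 : ℝ) π, cos kx₀ ∈ Ioo (wa : ℝ) wb ∧ ipBandK S kx₀ 0 = axisMax S := by
  obtain ⟨⟨w₀, hw₀, hw₀eq⟩, -⟩ := axisMax_spec S
  have hin := (axisMax_of_check hS h).2.1 w₀ hw₀ hw₀eq
  refine ⟨arccos w₀, ⟨arccos_nonneg w₀, arccos_le_pi w₀⟩, ?_, ?_⟩
  · rw [cos_arccos hw₀.1 hw₀.2]; exact hin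
  · rw [ipBandK_axis hS, cos_arccos hw₀.1 hw₀.2]; exact hw₀eq

/-! ## §4 The strip minimum: the axis maximiser is a saddle -/

/-- Two-variable kd certificate: `∂_v ε ≤ 0` on the strip `[wa, wb] × [v₁, 1]`. [cite: Moore1966, Theorem 3.1, §4.4] -/
def ipStripCheck (S : List (ℕ × ℕ × ℚ)) (wa wb v₁ : ℚ) (t : KdCert ℕ) : Bool :=
  decide (v₁ ≤ 1) && t.check (exprLeOn (ipBandVE S) 0) [(wa, wb), (v₁, 1)]

/-- **Strip minimum**: on `cos kx ∈ [wa, wb]`, the band is minimal ON the axis among `cos ky ≥ v₁`. [folklore] -/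
theorem strip_min_of_check {S : List (ℕ × ℕ × ℚ)} (hS : shellsOK S = true) {wa wb v₁ : ℚ} {t : KdCert ℕ}
    (h : ipStripCheck S wa wb v₁ t = true) {kx ky : ℝ} (hkx : cos kx ∈ Icc (wa : ℝ) wb) (hky : (v₁ : ℝ) ≤ cos ky) :
    ipBandK S kx 0 ≤ ipBandK S kx ky := by
  simp only [ipStripCheck, Bool.and_eq_true, decide_eq_true_eq] at h
  obtain ⟨hv, hk⟩ := h
  set u := cos kx with hu_def
  have huI : u ∈ Icc ((wa : ℚ) : ℝ) ((wb : ℚ) : ℝ) := hkx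
  have hd : ∀ v ∈ Icc (v₁ : ℝ) 1, ipBandU S v u ≤ 0 := by
    intro v hvv
    have hv' : v ∈ Icc ((v₁ : ℚ) : ℝ) (((1 : ℚ) : ℚ) : ℝ) := by simpa using hvv
    have := eval_le_of_kdCheck₂ (e := ipBandVE S) (b := 0) hk huI hv'
    simpa using this
  have hanti : AntitoneOn (fun v => ipBandUV S u v) (Icc (v₁ : ℝ) 1) := by
    refine antitoneOn_of_deriv_nonpos (convex_Icc _ _) ?_ ?_ ?_
    · exact fun v _ => (hasDerivAt_ipBandUV_v S u v).continuousAt.continuousWithinAt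
    · exact fun v _ => (hasDerivAt_ipBandUV_v S u v).differentiableAt.differentiableWithinAt
    · intro v hvv
      rw [interior_Icc] at hvv
      rw [(hasDerivAt_ipBandUV_v S u v).deriv]
      exact hd v (Ioo_subset_Icc_self hvv)
  have hv' : (v₁ : ℝ) ≤ 1 := by exact_mod_cast hv
  rw [ipBandK_eq_UV hS, ipBandK_eq_UV hS, cos_zero]
  exact hanti ⟨hky, cos_le_one ky⟩ ⟨hv', le_rfl⟩ (cos_le_one ky)

/-- **THE EXTENDED SADDLE.** Under the axis-maximum check and the strip check there is a momentum `(kx₀, 0)`,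
`cos kx₀ ∈ (wa, wb)`, where the band (i) attains its maximum `axisMax ∈ [e_lo, e_hi]` along the whole axis `ky = 0`,
(ii) is minimal across the axis (`cos ky ≥ v₁`) — a SADDLE off X — and (iii) `ε(X) ≤ e_side < e_lo`. [folklore] -/
theorem axisSaddle_of_checks {S : List (ℕ × ℕ × ℚ)} (hS : shellsOK S = true) {elo ehi eside wa wb wpt v₁ : ℚ}
    {t₁ t₂ t₃ ts : KdCert ℕ} (hm : axisMaxCheck S elo ehi eside wa wb wpt t₁ t₂ t₃ = true)
    (hst : ipStripCheck S wa wb v₁ ts = true) :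
    ∃ kx₀ ∈ Icc (0 : ℝ) π, cos kx₀ ∈ Ioo (wa : ℝ) wb ∧ ipBandK S kx₀ 0 = axisMax S ∧
      (∀ kx : ℝ, ipBandK S kx 0 ≤ ipBandK S kx₀ 0) ∧
      (∀ ky : ℝ, (v₁ : ℝ) ≤ cos ky → ipBandK S kx₀ 0 ≤ ipBandK S kx₀ ky) ∧
      axisMax S ∈ Icc (elo : ℝ) ehi ∧ ipBandK S π 0 ≤ (eside : ℝ) ∧ (eside : ℝ) < elo := by
  obtain ⟨kx₀, hk₀, hcos, heq⟩ := exists_axisMax hS hm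
  obtain ⟨hI, -, -, hX, hse⟩ := axisMax_of_check hS hm
  refine ⟨kx₀, hk₀, hcos, heq, fun kx => heq ▸ ipBandK_axis_le_axisMax hS kx,
    fun ky hky => strip_min_of_check hS hst (Ioo_subset_Icc_self hcos) hky, hI, hX, hse⟩

/-! ## §5 The two van Hove fillings by cell trees (`K = 384`) -/

/-- **FILLING AT `ε(X)`** (exact rational energy `ipBandQ S (−1) 1`) from one checked tree. [folklore] -/
theorem X_filling_of_tree {S : List (ℕ × ℕ × ℚ)} (hS : shellsOK S = true) {t : CellTree}
    (h : treeCheck 384 cosLo384T.get cosHi384T.get S (ipBandQ S (-1) 1) t = true) :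
    ipFilling S (ipBandK S π 0) ∈ Icc (((t.inner 0 384 0 384 : ℕ) : ℝ) / ((384 : ℕ) : ℝ) ^ 2)
      (((t.kept 0 384 0 384 : ℕ) : ℝ) / ((384 : ℕ) : ℝ) ^ 2) := by
  rw [ipBandK_X hS]
  exact ipFilling_mem_of_treeCheck (by norm_num) (by norm_num) cosEncl384 h

/-- **FILLING AT THE AXIS MAXIMUM** (the extended-saddle van Hove filling): trees checked at `e_lo` (inner count) and
`e_hi` (kept count) enclose `ipFilling S axisMax` by monotonicity of the filling. [folklore] -/
theorem axisMax_filling_of_trees {S : List (ℕ × ℕ × ℚ)} (hS : shellsOK S = true) {elo ehi eside wa wb wpt : ℚ}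
    {t₁ t₂ t₃ : KdCert ℕ} (hm : axisMaxCheck S elo ehi eside wa wb wpt t₁ t₂ t₃ = true) {tl th : CellTree}
    (hl : treeCheck 384 cosLo384T.get cosHi384T.get S elo tl = true)
    (hh : treeCheck 384 cosLo384T.get cosHi384T.get S ehi th = true) :
    ipFilling S (axisMax S) ∈ Icc (((tl.inner 0 384 0 384 : ℕ) : ℝ) / ((384 : ℕ) : ℝ) ^ 2)
      (((th.kept 0 384 0 384 : ℕ) : ℝ) / ((384 : ℕ) : ℝ) ^ 2) := by
  obtain ⟨⟨hlo, hhi⟩, -⟩ := axisMax_of_check hS hm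
  exact ⟨(inner_le_ipFilling (by norm_num) (by norm_num) cosEncl384 hl).trans (ipFilling_monotone S hlo),
    (ipFilling_monotone S hhi).trans (ipFilling_le_kept (by norm_num) (by norm_num) cosEncl384 hh)⟩

end Summit.Ventures.CertifiedManyBodySolver.Downfold.Emery
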